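import Mathlib

/-!
# Venture HSemireg — MOD-4 line: the numeric core of THEOREM A_{2n} — `2·C(2n−2,n−1) + 2n + 2 < C(2n,n)` for every `n ≥ 4`

HONEST FRAMING. Part of the Lean index of the computation cell `pub-hsemireg` (seat w3-mod4-1 gen 14, W3 SPECIAL FIBRES; file of
record `HOME/widen/W3/MOD4-OFFSPLIT-w3mod4.md` §10 (E24): «e_n = 2(C(2n−2,n−1) + n + 1) < C(2n,n) for n ≥ 4, by induction through
(m+1)(m+2) < m·C(2m,m) = the numeric core of THEOREM A_{2n}» — pencil there; §13.29: e_n is the kernel Euler-pin value of the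
`ch(O_Z)`-shape rows, `WeilFrameLeadingTermEulerPin`). PURE ARITHMETIC of central binomial coefficients: no abelian variety, no sheaf,
no Ext group, no semiregularity map; nothing here says that HC / HC_CM / HC_AV holds, or that any object is or is not semiregular
(the comparison of e_n with an Euler characteristic needs the HRR side and the pin identity, which are NOT formalised); no Literature
fact is declared; NO definition is introduced.

WHAT IS PROVED (all in `ℕ`):
* **`succ_mul_succ_succ_lt_mul_centralBinom`** — `(m+1)(m+2) < m·C(2m,m)` for `m ≥ 3` (`m = 3`: `20 < 60`; `m ≥ 4`: Mathlib's
  `Nat.four_pow_lt_mul_centralBinom` and `(m+1)(m+2) ≤ 4^m`);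
* **`two_mul_centralBinom_add_lt`** — `2·C(2m,m) + 2m + 4 < C(2m+2,m+1)` for `m ≥ 3` (from `(m+1)·C(2m+2,m+1) = 2(2m+1)·C(2m,m)`,
  Mathlib's `Nat.succ_mul_centralBinom_succ`);
* **`eulerPin_generic_lt_choose_middle`** — `2·C(2n−2,n−1) + 2n + 2 < C(2n,n)` for `n ≥ 4`, in the index form `(n + n − 2).choose (n − 1)`,
  `(n + n).choose n` used by `WeilFrameLeadingTermEulerPin` (`n = 4`: `50 < 70`; `n = 6`: `518 < 924`; false at `n = 2`: `10 > 6`).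
READING (MOD4-OFFSPLIT §10, not asserted in Lean): for EVEN `n ≥ 4` the generic Euler-pin value of an `O_Z`-shape Mukai vector is
`e_n = 2C(2n−2,n−1) + 2n + 2` (FILE 46) while HRR gives `χ(E,E)/D ≥ C(2n,n)·q_n²` plus a positive Weil term; this inequality is the step
«`e_n < C(2n,n)`». Everything PROVED, 0 sorry. Namespace `Summit.Ventures.HSemireg.Mod4`.
References: [BourbakiAlgebre1a3] Ch. III §8 (binomial identities); [BuchweitzFlenner2008HH] §6.4 (why the Euler pin; not formalised).
-/

namespace Summit.Ventures.HSemireg.Mod4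

open Nat

/-- **`(m+1)(m+2) < m·C(2m,m)` for `m ≥ 3`.** [cite: BourbakiAlgebre1a3, Ch. III §8] -/
theorem succ_mul_succ_succ_lt_mul_centralBinom {m : ℕ} (hm : 3 ≤ m) : (m + 1) * (m + 2) < m * Nat.centralBinom m := by
  rcases Nat.lt_or_ge m 4 with h4 | h4
  · have h3 : m = 3 := by omega
    subst h3
    decide
  · have hpow := Nat.four_pow_lt_mul_centralBinom m h4
    have h1 : m + 1 ≤ 2 ^ m := Nat.lt_two_pow_self
    have h2 : m + 2 ≤ 2 ^ m := by
      obtain ⟨k, rfl⟩ : ∃ k, m = k + 1 := ⟨m - 1, by omega⟩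
      have hk : k < 2 ^ k := Nat.lt_two_pow_self
      rw [pow_succ]
      omega
    have h12 : (m + 1) * (m + 2) ≤ 4 ^ m := by
      calc (m + 1) * (m + 2) ≤ 2 ^ m * 2 ^ m := Nat.mul_le_mul h1 h2
        _ = 4 ^ m := by rw [← mul_pow]; norm_num
    exact lt_of_le_of_lt h12 hpow

/-- **`2·C(2m,m) + 2m + 4 < C(2m+2,m+1)` for `m ≥ 3`** (`(m+1)·C(2m+2,m+1) = 2(2m+1)·C(2m,m)` and the previous lemma).
[cite: BourbakiAlgebre1a3, Ch. III §8] -/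
theorem two_mul_centralBinom_add_lt {m : ℕ} (hm : 3 ≤ m) :
    2 * Nat.centralBinom m + 2 * m + 4 < Nat.centralBinom (m + 1) := by
  have hrec := Nat.succ_mul_centralBinom_succ m
  have hlt := succ_mul_succ_succ_lt_mul_centralBinom hm
  have key : (m + 1) * (2 * Nat.centralBinom m + 2 * m + 4) < (m + 1) * Nat.centralBinom (m + 1) := by nlinarith
  exact Nat.lt_of_mul_lt_mul_left key

/-- **the numeric core of THEOREM A_{2n}:** `2·C(2n−2,n−1) + 2n + 2 < C(2n,n)` for `n ≥ 4` (index form of `WeilFrameLeadingTermEulerPin`).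
[cite: BourbakiAlgebre1a3, Ch. III §8] -/
theorem eulerPin_generic_lt_choose_middle {n : ℕ} (hn : 4 ≤ n) :
    2 * (n + n - 2).choose (n - 1) + 2 * n + 2 < (n + n).choose n := by
  obtain ⟨m, rfl⟩ : ∃ m, n = m + 1 := ⟨n - 1, by omega⟩
  have h := two_mul_centralBinom_add_lt (m := m) (by omega)
  rw [Nat.centralBinom_eq_two_mul_choose, Nat.centralBinom_eq_two_mul_choose] at h
  rw [show m + 1 + (m + 1) - 2 = 2 * m by omega, show m + 1 - 1 = m by omega, show m + 1 + (m + 1) = 2 * (m + 1) by ring]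
  omega

end Summit.Ventures.HSemireg.Mod4
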